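import Summits.ResolutionOfSingularities.ResolutionOfSingularities.Theorems.EquisingularLiftEquisingularLiftNatMultiOrdinaryPoints
import Summits.ResolutionOfSingularities.ResolutionOfSingularities.Theorems.EquisingularLiftEquisingularLiftBlowupModelTransport
import HarnessLib

/-!
# Crux `EquisingularLift` (stmt-ResolutionOfSingularities-15660), line `Sketch` (v10c): the OPEN residual `stub_blowupModel_ge_five` holds for
# every hypersurface whose singular points are ORDINARY MULTIPLE POINTS at coordinate vertices — every characteristic, every dimension

[OURS · leafhand-res-equisingularlift-7 g1, 2026-08-31; cell `pub/decomp-res`] AI-produced, weaker than expert review; NOT a statement of any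
manuscript; nothing here proves resolution of singularities in positive characteristic.  DEF-FREE helper, `--supports stmt-…-15660`; standard
axioms; ZERO named hypotheses; every field `K` (no algebraic closure, no characteristic hypothesis).

Seat res-D-pv-013's T-MULTIORD ✓ `MultiOrd.elNatAt_ordinaryPoints` (…NatMultiOrdinaryPoints) proves, on its way to the route currency `ELNatAt`
(which needs `K = K̄` of characteristic `p` and the Witt lift), the purely DOWNSTAIRS statement «every blow-up of `H = V₊(F)` along the product
`Π_{c ∈ S} Λ_c·𝒪_H` of the marked vertex points is a regular scheme», but does not record it.  Here it is recorded as a theorem of its own, over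
ANY field, and read in the currency of the open residual of crux `EquisingularLift` («`∃ 𝔞 ≠ ⊥` on `H` all of whose blow-ups are regular»,
= «`H` has a projective resolution», ✓ `blowupModel_iff_projectiveResolution`):

* `MultiOrd.isRegular_of_isBlowup_comap_prod` — `F ∈ K[x₀,…,x_{m+2}]` a prime form, `S` a duplicate-free list of coordinates, for `c ∈ S` the
  vertex chart `F(x_c := 1) = Φ_c + Ψ_c` with `Φ_c` a NONSINGULAR form of degree `μ_c ≥ 1`, `Ψ_c ∈ (y)^{μ_c+1}` and `F(x_c := 1)` singular at most
  at the origin (prime-ideal Jacobian hypothesis), the charts `c ∉ S` regular: **every blow-up of `H` along `Π_{c∈S} Λ_c·𝒪_H` is regular**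
  (verbatim the third step of ✓ `MultiOrd.elNatAt_ordinaryPoints`: ✓ `MultiCentre.isRegular_of_prod`, ✓ `OrdPointAt.isRegularLocalRing_stalk_of_isBlowup_comap`,
  ✓ `MultiOrd.isRegularLocalRing_stalk_of_forall_exists`);
* `MultiOrd.comap_prod_ne_bot` — that ideal sheaf is `≠ ⊥` (the point `pointOfPrime F` of `H` is no vertex: a prime form lies in at most one `(x_a)`);
* ★ `StrataSplit.blowupModel_ordinaryPoints` — **hence `H` has a regular blow-up model**: an ALL-CHARACTERISTIC, ALL-DIMENSION family of
  instances of the conclusion of `stub_blowupModel_ge_five` (next to ✓ `blowupModel_cone` / `blowupModel_linCone` / `blowupModel_of_range_eq_quadric` /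
  `blowupModel_submaxLinN` / `blowupModel_largeChar`) — e.g. every nodal hypersurface with nodes at (some of) the coordinate vertices;
* ★ `StrataSplit.blowupModel_of_range_eq_ordinaryPoints` — the same in the crux's binder shape `(H, ι)`, `range ι = V₊(F)` (✓ `blowupModel_of_range_eq`).

Honest label: no registered stub closed; `stub_blowupModel_ge_five` stays OPEN; these are instances of its conclusion.

References: [Hartshorne1977, I Thm. 5.1, II Prop. 5.9, II Ex. 7.12]; [StacksProject, Tags 080A, 0804, 0BIQ]; [Matsumura1987, Thm. 14.2] — through the cited
tree files.
-/

set_option linter.dupNamespace false -- mandated namespace `Summit.<Summit>.<Problem>` of this single-conjunct summit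

noncomputable section

open CategoryTheory CategoryTheory.Limits AlgebraicGeometry TopologicalSpace
open MvPolynomial HomogeneousLocalization
open Literature.AlgebraicGeometry.Resolution
open Literature.AlgebraicGeometry.Motives Literature.AlgebraicGeometry.Motives.SmoothHypersurface
open Literature.AlgebraicGeometry.Motives.ProjectiveSpace
open AlgebraicGeometry.Scheme.IdealSheafData
open Summit.ResolutionOfSingularities.ResolutionOfSingularities.Cruxes.EquisingularLift.StrataSplit

namespace Summit.ResolutionOfSingularities.ResolutionOfSingularities.Cruxes.EquisingularLiftNat.Sections

namespace MultiOrd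

variable (K : Type) [Field K] {m : ℕ} (F : MvPolynomial (Fin (m + 2 + 1)) K) {d : ℕ} (hF : F.IsHomogeneous d) (hFp : Prime F)

include hFp in
/-- **DOWNSTAIRS, over any field: every blow-up of `H = V₊(F)` along the product `Π_{c∈S} Λ_c·𝒪_H` of marked vertex points is regular** when `F` is a
prime form, each marked vertex `P_c` (`c ∈ S`, `S` duplicate-free) is an ORDINARY multiple point (`F(x_c := 1) = Φ + Ψ`, `Φ` a nonsingular form of
degree `μ ≥ 1`, `Ψ ∈ (y)^{μ+1}`) at which the chart `F(x_c := 1)` has its only singularity (prime-ideal Jacobian hypothesis), and the charts `c ∉ S`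
are regular rings.  Here `Λ_c = ker Proj(f_c)` for kill maps `f_c` (`x_c ↦ x₀`, `x_i ↦ 0` otherwise).  Verbatim the downstairs step of
✓ `MultiOrd.elNatAt_ordinaryPoints`: blow-ups along a product of centres with disjoint supports are regular where the factor blow-ups are
(✓ `MultiCentre.isRegular_of_prod`), each factor pointwise (✓ `OrdPointAt.isRegularLocalRing_stalk_of_isBlowup_comap`), `H` regular off the marked
vertices (✓ `isRegularLocalRing_stalk_of_forall_exists`). [cite: StacksProject, Tag 080A] [cite: Hartshorne1977, I Thm. 5.1] [cite: Matsumura1987, Thm. 14.2] -/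
theorem isRegular_of_isBlowup_comap_prod (S : List (Fin (m + 2 + 1))) (hS : S.Nodup)
    (hord : ∀ c ∈ S, ∃ (μ : ℕ) (Φ Ψ : MvPolynomial (Fin (m + 2)) K), 1 ≤ μ ∧ Φ.IsHomogeneous μ ∧ IsNonsingularForm K Φ ∧
      Ψ ∈ Ideal.span (Set.range (X : Fin (m + 2) → MvPolynomial (Fin (m + 2)) K)) ^ (μ + 1) ∧ ProjectiveSpace.dehomogenize K c F = Φ + Ψ)
    (hsing : ∀ c ∈ S, ∀ P : Ideal (MvPolynomial (Fin (m + 2)) K), P.IsPrime → ProjectiveSpace.dehomogenize K c F ∈ P →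
      (∀ j, pderiv j (ProjectiveSpace.dehomogenize K c F) ∈ P) → ∀ j, (X j : MvPolynomial (Fin (m + 2)) K) ∈ P) :
    letI := MvPolynomial.gradedAlgebra (σ := Fin (m + 2 + 1)) (R := K)
    letI := MvPolynomial.gradedAlgebra (σ := Fin (0 + 1)) (R := K)
    ∀ (_hoffS : ∀ c, c ∉ S → IsRegularRing (ChartRing F c hF))
      (fk : Fin (m + 2 + 1) → (homogeneousSubmodule (Fin (m + 2 + 1)) K →+*ᵍ homogeneousSubmodule (Fin (0 + 1)) K))
      (hfk' : ∀ c, HomogeneousIdeal.irrelevant (homogeneousSubmodule (Fin (0 + 1)) K) ≤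
        (HomogeneousIdeal.irrelevant (homogeneousSubmodule (Fin (m + 2 + 1)) K)).map (fk c))
      (_hfkC : ∀ c (a : K), fk c (C a) = C a) (_hfke : ∀ c (j : Fin 1), fk c (X c) = X j)
      (_hfk0 : ∀ c (i : Fin (m + 2 + 1)), i ≠ c → fk c (X i) = 0)
      (Z : Scheme.{0}) (ρ : Z ⟶ (hypersurface F).left),
      IsBlowup ρ (((S.map fun c => (Proj.map (fk c) (hfk' c)).ker).prod).comap (hypersurfaceι F).left) → Scheme.IsRegular Z := by
  letI := MvPolynomial.gradedAlgebra (σ := Fin (m + 2 + 1)) (R := K)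
  letI := MvPolynomial.gradedAlgebra (σ := Fin (0 + 1)) (R := K)
  intro hoffS fk hfk' hfkC hfke hfk0 Z ρ hρ
  classical
  have hd : 0 < d := ConeN.pos_of_prime_of_isHomogeneous K F hF hFp
  have he : ∀ c : Fin (m + 2 + 1), Function.Injective (fun _ : Fin 1 => c) := fun c => Function.injective_of_subsingleton _
  have hec : ∀ c : Fin (m + 2 + 1), ∀ j : Fin 1, (fun _ : Fin 1 => c) j = c := fun _ _ => rfl
  have hfkeR : ∀ c, ∀ j : Fin 1, fk c (X ((fun _ : Fin 1 => c) j)) = X j := fun c j => hfke c j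
  have hfk0R : ∀ c, ∀ i : Fin (m + 2 + 1), i ∉ Set.range (fun _ : Fin 1 => c) → fk c (X i) = 0 :=
    fun c i hi => hfk0 c i (fun h => hi ⟨0, h.symm⟩)
  -- radicality of the chart equations at the marked vertices
  have hrad : ∀ c ∈ S, (Ideal.span {ProjectiveSpace.dehomogenize K c F}).radical = Ideal.span {ProjectiveSpace.dehomogenize K c F} := by
    intro c hc
    obtain ⟨μ, Φ, Ψ, hμ, hΦ, -, hΨ, hdeh⟩ := hord c hc
    rw [hdeh]
    exact OrdPointAt.radical_span_dehomogenize_eq K F c hF hFp Φ Ψ hΦ hμ hΨ hdeh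
  rw [MultiCentre.comap_list_prod, List.map_map] at hρ
  refine MultiCentre.isRegular_of_prod _ ?_ ?_ ?_ hρ
  · -- pairwise disjoint supports
    rw [List.pairwise_map]
    refine hS.pairwise_of_forall_ne fun c _ c' _ hcc' => ?_
    simp only [Function.comp_apply]
    rw [Set.disjoint_iff]
    rintro x ⟨hx, hx'⟩
    have h1 : (hypersurfaceι F).left x ∈ ((Proj.map (fk c) (hfk' c)).ker.support : Set (Proj (homogeneousSubmodule (Fin (m + 2 + 1)) K))) := by
      have h := hx; rwa [Scheme.IdealSheafData.support_comap] at h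
    have h2 : (hypersurfaceι F).left x ∈ ((Proj.map (fk c') (hfk' c')).ker.support : Set (Proj (homogeneousSubmodule (Fin (m + 2 + 1)) K))) := by
      have h := hx'; rwa [Scheme.IdealSheafData.support_comap] at h
    exact (CoordPoints.disjoint_support_ker fk hfk' hfkC hfke hfk0 hcc').le_bot ⟨h1, h2⟩
  · -- each factor: an ordinary point, resolved pointwise; off it the blow-up is a local isomorphism
    intro I hI X₁ τ₁ hτ₁ z hz
    obtain ⟨c, hc, rfl⟩ := List.mem_map.mp hI
    simp only [Function.comp_apply] at hτ₁ hz ⊢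
    by_cases hzs : τ₁ z ∈ ((((Proj.map (fk c) (hfk' c)).ker).comap (hypersurfaceι F).left).support : Set (hypersurface F).left)
    · obtain ⟨μ, Φ, Ψ, hμ, hΦ, hns, hΨ, hdeh⟩ := hord c hc
      exact OrdPointAt.isRegularLocalRing_stalk_of_isBlowup_comap K F c hF hFp (hec c) (fk c) (hfk' c) (hfkC c) (hfkeR c) (hfk0R c)
        Φ Ψ hΦ hμ hns hΨ hdeh hτ₁ z hzs
    · rcases hz with hz | hz
      · exact absurd hz hzs
      · haveI := hτ₁.isIso_stalkMap_of_not_mem_support hzs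
        haveI : IsRegularLocalRing ((hypersurface F).left.presheaf.stalk (τ₁ z)) := hz
        exact IsRegularLocalRing.of_ringEquiv (R := (hypersurface F).left.presheaf.stalk (τ₁ z)) (asIso (τ₁.stalkMap z)).commRingCatIsoToRingEquiv
  · -- `H` is regular off the marked vertices
    intro x hx
    refine isRegularLocalRing_stalk_of_forall_exists K F hF hd S (fun c hc => ⟨hrad c hc, hsing c hc⟩) hoffS x (fun c hc => ?_)
    have hxc : (hypersurfaceι F).left x ∉ ((Proj.map (fk c) (hfk' c)).ker.support : Set (Proj (homogeneousSubmodule (Fin (m + 2 + 1)) K))) := by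
      intro h
      apply hx
      rw [IdealSheafData.coe_support_prod, Set.mem_iUnion₂]
      refine ⟨_, List.mem_map.mpr ⟨c, hc, rfl⟩, ?_⟩
      simp only [Function.comp_apply]
      rw [Scheme.IdealSheafData.support_comap]
      exact h
    obtain ⟨a, ha, hXa⟩ := LinearCentre.exists_X_not_mem_of_not_mem_support (fun _ : Fin 1 => c) (he c) (fk c) (hfk' c) (hfkC c) (hfkeR c)
      (hfk0R c) hxc
    exact ⟨a, (OrdPointAt.not_mem_range_iff c (hec c) a).mp ha, (Proj.mem_basicOpen _ _ _).mpr hXa⟩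

include hF hFp in
/-- **The trace on `H = V₊(F)` of the product of marked vertex points is a non-zero ideal sheaf** (`F` a prime form, any field, any list `S`): were it
`⊥`, its support would be all of `H`, so the point `pointOfPrime F ∈ H` would be one of the vertices `P_c`, i.e. `x_a ∈ 𝔭` for all `a ≠ c` — but a
prime form lies in at most one `(x_a)` (✓ `exists_X_ne_not_mem_span`). [folklore] -/
theorem comap_prod_ne_bot (S : List (Fin (m + 2 + 1))) :
    letI := MvPolynomial.gradedAlgebra (σ := Fin (m + 2 + 1)) (R := K)
    letI := MvPolynomial.gradedAlgebra (σ := Fin (0 + 1)) (R := K)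
    ∀ (fk : Fin (m + 2 + 1) → (homogeneousSubmodule (Fin (m + 2 + 1)) K →+*ᵍ homogeneousSubmodule (Fin (0 + 1)) K))
      (hfk' : ∀ c, HomogeneousIdeal.irrelevant (homogeneousSubmodule (Fin (0 + 1)) K) ≤
        (HomogeneousIdeal.irrelevant (homogeneousSubmodule (Fin (m + 2 + 1)) K)).map (fk c))
      (_hfkC : ∀ c (a : K), fk c (C a) = C a) (_hfke : ∀ c (j : Fin 1), fk c (X c) = X j)
      (_hfk0 : ∀ c (i : Fin (m + 2 + 1)), i ≠ c → fk c (X i) = 0),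
      (((S.map fun c => (Proj.map (fk c) (hfk' c)).ker).prod).comap (hypersurfaceι F).left) ≠ ⊥ := by
  letI := MvPolynomial.gradedAlgebra (σ := Fin (m + 2 + 1)) (R := K)
  letI := MvPolynomial.gradedAlgebra (σ := Fin (0 + 1)) (R := K)
  intro fk hfk' hfkC hfke hfk0
  classical
  haveI := HypersurfaceSpecimen.isIntegral_hypersurface_of_prime K F hF hFp
  intro h0
  have hmem : (pointOfPrime F hF hFp : Proj (homogeneousSubmodule (Fin (m + 2 + 1)) K)) ∈ Set.range (hypersurfaceι F).left := by
    refine (Set.ext_iff.mp (range_hypersurfaceι F) _).mpr ((ProjectiveSpectrum.mem_zeroLocus _ _ _).mpr (Set.singleton_subset_iff.mpr ?_))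
    exact Ideal.subset_span rfl
  obtain ⟨x, hx⟩ := hmem
  have hxs : x ∈ ((((S.map fun c => (Proj.map (fk c) (hfk' c)).ker).prod).comap (hypersurfaceι F).left).support :
      Set (hypersurface F).left) := by
    rw [h0, Scheme.IdealSheafData.support_bot]; trivial
  rw [Scheme.IdealSheafData.support_comap] at hxs
  have hxs' : (pointOfPrime F hF hFp : Proj (homogeneousSubmodule (Fin (m + 2 + 1)) K)) ∈
      ((((S.map fun c => (Proj.map (fk c) (hfk' c)).ker).prod)).support : Set (Proj (homogeneousSubmodule (Fin (m + 2 + 1)) K))) := by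
    rw [← hx]; exact hxs
  obtain ⟨c, -, hyc⟩ := (CoordPoints.mem_support_prod_iff fk hfk' S _).mp hxs'
  obtain ⟨a, hac, ha⟩ := exists_X_ne_not_mem_span K F hFp c
  exact ha (CoordPoints.X_mem_of_mem_support fk hfk' hfkC hfke hfk0 hyc hac)

end MultiOrd

end Summit.ResolutionOfSingularities.ResolutionOfSingularities.Cruxes.EquisingularLiftNat.Sections

namespace Summit.ResolutionOfSingularities.ResolutionOfSingularities.Cruxes.EquisingularLift.StrataSplit

open Summit.ResolutionOfSingularities.ResolutionOfSingularities.Cruxes.EquisingularLiftNat.Sections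
open Summit.ResolutionOfSingularities.ResolutionOfSingularities.Cruxes.EquisingularLiftNat

/-- ★ **Hypersurfaces whose singular points are ORDINARY MULTIPLE POINTS at coordinate vertices have regular blow-up models — every field, every
characteristic, every dimension.**  `F ∈ K[x₀,…,x_{m+2}]` a prime form; `S` a duplicate-free list of coordinates; for `c ∈ S` the vertex chart
`F(x_c := 1) = Φ + Ψ` with `Φ` a NONSINGULAR form of degree `μ ≥ 1` and `Ψ ∈ (y)^{μ+1}` (`P_c` an ordinary `μ`-fold point), singular at most at the origin
(prime-ideal Jacobian hypothesis); the charts `c ∉ S` regular.  Then `H = V₊(F)` carries a non-zero ideal sheaf — the trace of the product of the vertex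
points `P_c`, `c ∈ S` — ALL of whose blow-ups are regular (`MultiOrd.isRegular_of_isBlowup_comap_prod`, `MultiOrd.comap_prod_ne_bot`): the conclusion of
the open residual `stub_blowupModel_ge_five` at these `H`; e.g. every hypersurface with nodes at some coordinate vertices and no other singularity, such as
Cayley's 4-nodal cubic surface, in every characteristic. [cite: Hartshorne1977, II Ex. 7.12] [cite: StacksProject, Tag 080A] -/
theorem blowupModel_ordinaryPoints (K : Type) [Field K] {m : ℕ} (F : MvPolynomial (Fin (m + 2 + 1)) K) {d : ℕ} (hF : F.IsHomogeneous d)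
    (hFp : Prime F) (S : List (Fin (m + 2 + 1))) (hS : S.Nodup)
    (hord : ∀ c ∈ S, ∃ (μ : ℕ) (Φ Ψ : MvPolynomial (Fin (m + 2)) K), 1 ≤ μ ∧ Φ.IsHomogeneous μ ∧ IsNonsingularForm K Φ ∧
      Ψ ∈ Ideal.span (Set.range (X : Fin (m + 2) → MvPolynomial (Fin (m + 2)) K)) ^ (μ + 1) ∧ ProjectiveSpace.dehomogenize K c F = Φ + Ψ)
    (hsing : ∀ c ∈ S, ∀ P : Ideal (MvPolynomial (Fin (m + 2)) K), P.IsPrime → ProjectiveSpace.dehomogenize K c F ∈ P →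
      (∀ j, pderiv j (ProjectiveSpace.dehomogenize K c F) ∈ P) → ∀ j, (X j : MvPolynomial (Fin (m + 2)) K) ∈ P)
    (hoffS : letI := MvPolynomial.gradedAlgebra (σ := Fin (m + 2 + 1)) (R := K)
      ∀ c, c ∉ S → IsRegularRing (ChartRing F c hF)) :
    letI := MvPolynomial.gradedAlgebra (σ := Fin (m + 2 + 1)) (R := K)
    ∃ 𝔞 : (hypersurface F).left.IdealSheafData, 𝔞 ≠ ⊥ ∧
      ∀ (Z : Scheme.{0}) (π : Z ⟶ (hypersurface F).left), IsBlowup π 𝔞 → Scheme.IsRegular Z := by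
  letI := MvPolynomial.gradedAlgebra (σ := Fin (m + 2 + 1)) (R := K)
  letI := MvPolynomial.gradedAlgebra (σ := Fin (0 + 1)) (R := K)
  have he : ∀ c : Fin (m + 2 + 1), Function.Injective (fun _ : Fin 1 => c) := fun c => Function.injective_of_subsingleton _
  have hexk : ∀ c : Fin (m + 2 + 1), ∃ (g : homogeneousSubmodule (Fin (m + 2 + 1)) K →+*ᵍ homogeneousSubmodule (Fin (0 + 1)) K)
      (_ : HomogeneousIdeal.irrelevant (homogeneousSubmodule (Fin (0 + 1)) K) ≤
        (HomogeneousIdeal.irrelevant (homogeneousSubmodule (Fin (m + 2 + 1)) K)).map g),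
      (∀ a : K, g (C a) = C a) ∧ (∀ j : Fin 1, g (X ((fun _ : Fin 1 => c) j)) = X j) ∧
        (∀ i : Fin (m + 2 + 1), i ∉ Set.range (fun _ : Fin 1 => c) → g (X i) = 0) := fun c =>
    Summit.ResolutionOfSingularities.ResolutionOfSingularities.Cruxes.EquisingularLiftNat.LinearCentre.exists_kill (R := K) (fun _ : Fin 1 => c) (he c)
  choose fk hfk' hfkC hfke hfk0 using hexk
  have hfke' : ∀ c (j : Fin 1), fk c (X c) = X j := fun c j => hfke c j
  have hfk0' : ∀ c (i : Fin (m + 2 + 1)), i ≠ c → fk c (X i) = 0 := fun c i hi => hfk0 c i (fun ⟨_, hj⟩ => hi hj.symm)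
  exact ⟨_, MultiOrd.comap_prod_ne_bot K F hF hFp S fk hfk' hfkC hfke' hfk0',
    fun Z ρ hρ => MultiOrd.isRegular_of_isBlowup_comap_prod K F hF hFp S hS hord hsing hoffS fk hfk' hfkC hfke' hfk0' Z ρ hρ⟩

/-- ★ **The same in the crux's binder shape** — every field: for the crux's `ι : H ↪ ℙ^{m+2}_K` (closed immersion, `H` integral) with `range ι = V₊(F)`,
`F` a prime form whose singular points are ordinary multiple points at coordinate vertices (hypotheses of `blowupModel_ordinaryPoints`), `H` has a
non-zero ideal sheaf all of whose blow-ups are regular (✓ `blowupModel_of_range_eq`). [cite: Hartshorne1977, II Ex. 7.12] -/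
theorem blowupModel_of_range_eq_ordinaryPoints {K : Type} [Field K] {m : ℕ} {H : Scheme.{0}}
    (ι : H ⟶ (projectiveSpace (m + 2) K).left) [IsClosedImmersion ι] [IsIntegral H]
    (F : MvPolynomial (Fin (m + 2 + 1)) K) {d : ℕ} (hF : F.IsHomogeneous d) (hFp : Prime F) (S : List (Fin (m + 2 + 1))) (hS : S.Nodup)
    (hord : ∀ c ∈ S, ∃ (μ : ℕ) (Φ Ψ : MvPolynomial (Fin (m + 2)) K), 1 ≤ μ ∧ Φ.IsHomogeneous μ ∧ IsNonsingularForm K Φ ∧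
      Ψ ∈ Ideal.span (Set.range (X : Fin (m + 2) → MvPolynomial (Fin (m + 2)) K)) ^ (μ + 1) ∧ ProjectiveSpace.dehomogenize K c F = Φ + Ψ)
    (hsing : ∀ c ∈ S, ∀ P : Ideal (MvPolynomial (Fin (m + 2)) K), P.IsPrime → ProjectiveSpace.dehomogenize K c F ∈ P →
      (∀ j, pderiv j (ProjectiveSpace.dehomogenize K c F) ∈ P) → ∀ j, (X j : MvPolynomial (Fin (m + 2)) K) ∈ P)
    (hoffS : letI := MvPolynomial.gradedAlgebra (σ := Fin (m + 2 + 1)) (R := K)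
      ∀ c, c ∉ S → IsRegularRing (ChartRing F c hF))
    (hrange : letI := MvPolynomial.gradedAlgebra (σ := Fin (m + 2 + 1)) (R := K)
      Set.range ι = {x : Proj (homogeneousSubmodule (Fin (m + 2 + 1)) K) | F ∈ x.asHomogeneousIdeal}) :
    ∃ 𝔞 : H.IdealSheafData, 𝔞 ≠ ⊥ ∧ ∀ (Z : Scheme.{0}) (π : Z ⟶ H), IsBlowup π 𝔞 → Scheme.IsRegular Z :=
  letI := MvPolynomial.gradedAlgebra (σ := Fin (m + 2 + 1)) (R := K)
  blowupModel_of_range_eq ι F hF hFp hrange (blowupModel_ordinaryPoints K F hF hFp S hS hord hsing hoffS)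

end Summit.ResolutionOfSingularities.ResolutionOfSingularities.Cruxes.EquisingularLift.StrataSplit

end
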